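import Literature.NumberTheory.GelbartRogawski1991.Sec6

/-!
# Gelbart–Rogawski 1991, §6 — the pure-logic consequences (K items) of the §6 carpet ★ `Sec6.lean`

Sibling PROOF file of the statement carpet ★ `Literature/NumberTheory/GelbartRogawski1991/Sec6.lean`
(squad TG, seat TG-t04; squad RULING 3 (a): carpets carry no theorems, their pure-logic corollaries live
in a separate file; namespace `Literature.NumberTheory.GelbartRogawski1991.Sec6Proofs`).  Nothing is posited here and no named fact is introduced: the three theorems are
IMPLICATIONS between the named facts of ★ `Sec6` (and are therefore unconditional theorems of Literature,
axioms ⊆ {propext, Classical.choice, Quot.sound}); they make the printed proof architecture of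
Proposition 6.2.1 kernel-checked:

* `prop621_of` — [GelbartRogawski1991, proof of Prop. 6.2.1, p. 469 L19–21]: «For almost all `v`, `π_v` is
  the Howe lift of `σ_v`» (`Sec6Data.thetaLift_loc`) «and hence, by the strong multiplicity one theorem for
  L-packets ([R])» (`strongMultOne_packetL`) «it suffices to prove» Lemma 6.2.2 (`Sec6Data.lemma622`,
  first sentence) — these three named facts imply `prop621` (uniform form), with Lemma 6.2.2's `ϱ`.
* `prop621_pointwise` — the pointwise reading of Proposition 6.2.1 («… belong to `Π(ϱ)` for some `ϱ`»,
  one `π` at a time) from the uniform form.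
* `mem_packetL_iff_isThetaLift` — with the opening sentence of §6.2 (`cuspidal_isThetaLift`, p. 469
  L11–12) and Prop. 6.2.1: a cuspidal `π` lies in some `Π(ϱ)` (`ϱ` a cuspidal L-packet on `H`) iff it is
  a theta-series lifting from some `U(Φ′)` in two variables — the two-variable half of the gloss p. 469
  L16–18 «the set of discrete endoscopic representations of `U(3)` coincides with the set of theta series
  lifts from unitary groups `U(Φ′)` where `Φ′` is a Hermitian form in 1 or 2 variables».

References: S. Gelbart, J. Rogawski, Invent. Math. 105 (1991) 445–472, §6.2 p. 469. [GelbartRogawski1991]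
-/

namespace Literature.NumberTheory.GelbartRogawski1991.Sec6Proofs

open Filter Sec6

universe u

variable {X : GR91Spectrum.{u}} {HeckeE HeckeF : Type u} [CommGroup HeckeE] [CommGroup HeckeF]
  {D : Sec1Defs.EndoscopicLData X HeckeE HeckeF} {T : Sec5Defs.ThetaLiftData X}

/-- **K — the printed proof architecture of Proposition 6.2.1**: «For almost all `v`, `π_v` is the Howe
lift of `σ_v`» (`thetaLift_loc`) and Lemma 6.2.2 (first sentence: a cuspidal `ϱ = ϱ₂ × ϱ₁` receives the
Howe lifts of `σ_v` for almost all `v`) put `π_v` in `Π(ϱ_v)` for almost all `v`, whence `π ∈ Π(ϱ)` «by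
the strong multiplicity one theorem for L-packets ([R])» (`strongMultOne_packetL`); the `ϱ` obtained is
Lemma 6.2.2's, uniform in `π` — i.e. `prop621`.
[cite: GelbartRogawski1991, proof of Proposition 6.2.1 (p. 469 L19–21)] -/
theorem prop621_of (S : Sec6Data X D T) (hloc : S.thetaLift_loc) (h622 : S.lemma622)
    (hsmo : strongMultOne_packetL D) : prop621 D T := by
  intro H hH σ d
  obtain ⟨ϱ₂, ϱ₁, hcusp, hinto⟩ := (h622 H hH σ d).1
  refine ⟨ϱ₂, ϱ₁, hcusp, fun π hc hθ => hsmo π hc ϱ₂ ϱ₁ hcusp ?_⟩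
  filter_upwards [hloc H hH σ d π hc hθ, hinto] with v hv hw
  exact hw.2 _ hv

/-- K.  The pointwise reading of Proposition 6.2.1 — «all irreducible cuspidal subrepresentations `π` of
`Θ(ψ, s, σ)` belong to `Π(ϱ)` for some `ϱ`», one `π` at a time — from the uniform form `prop621`.
[cite: GelbartRogawski1991, Proposition 6.2.1 (p. 469 L13–15)] -/
theorem prop621_pointwise (h : prop621 D T) (H : T.UGrp) (hH : T.dim H = 2) (σ : T.CuspRep H)
    (d : T.ThetaDatum H) (π : X.Rep) (hc : D.IsCuspidal π) (hθ : Sec5Defs.IsThetaLift T H σ d π) :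
    ∃ (ϱ₂ : D.PacketU2) (ϱ₁ : X.Char1), D.IsCuspidalU2 ϱ₂ ∧ π ∈ D.packetL ϱ₂ ϱ₁ := by
  obtain ⟨ϱ₂, ϱ₁, hcusp, hall⟩ := h H hH σ d
  exact ⟨ϱ₂, ϱ₁, hcusp, hall π hc hθ⟩

/-- K.  With the opening sentence of §6.2 («By the above theorem, every cuspidal element in `Π(ϱ)` is a
theta-series lift from some `U(Φ′)`», `cuspidal_isThetaLift`) and Proposition 6.2.1 (`prop621`): a
cuspidal `π` lies in some `Π(ϱ)` (`ϱ` a cuspidal L-packet on `H`) iff it is a theta-series lifting from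
some `U(Φ′)` in two variables — the two-variable half of the gloss «Together with Theorem 5.1.1, this
shows that the set of discrete endoscopic representations of `U(3)` coincides with the set of theta
series lifts from unitary groups `U(Φ′)` where `Φ′` is a Hermitian form in 1 or 2 variables».
[cite: GelbartRogawski1991, §6.2 p. 469 L11–18] -/
theorem mem_packetL_iff_isThetaLift (h61 : cuspidal_isThetaLift D T) (h621 : prop621 D T) (π : X.Rep)
    (hc : D.IsCuspidal π) :
    (∃ (ϱ₂ : D.PacketU2) (ϱ₁ : X.Char1), D.IsCuspidalU2 ϱ₂ ∧ π ∈ D.packetL ϱ₂ ϱ₁) ↔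
      ∃ H : T.UGrp, T.dim H = 2 ∧
        ∃ (σ : T.CuspRep H) (d : T.ThetaDatum H), Sec5Defs.IsThetaLift T H σ d π := by
  constructor
  · rintro ⟨ϱ₂, ϱ₁, hcusp, hπ⟩
    exact h61 ϱ₂ ϱ₁ hcusp π hπ hc
  · rintro ⟨H, hH, σ, d, hθ⟩
    exact prop621_pointwise h621 H hH σ d π hc hθ

end Literature.NumberTheory.GelbartRogawski1991.Sec6Proofs
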